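import Literature.MathematicalPhysics.QuantumFieldTheory.Federbush1986.LipschitzMollifier

/-!
# `Federbush1986.BallCutoffs` — [Federbush1988PhaseCellIV] Appendix A, part C, proof of Theorem A.3, (A.29)–(A.30) p. 342:
# the scale function `d(x) ≍ d(x, ∂B)` on the unit ball and a dyadic `C^∞` partition of unity of the open ball adapted
# to it, with the derivative bounds `‖D^iψ_j‖ ≤ P·2^{ji}` — PROVED (bookkeeping for the variable mollification scale `εd(x)`)

statement-level skeleton of published theorems with citation tags; proofs where landed; nothing here is a claim about the Yang–Mills mass gap

CITATION HEADER.  P. Federbush, *A phase cell approach to Yang–Mills theory. IV. The choice of variables*, Commun. Math.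
Phys. **114** (1988) 317–343 [Federbush1988PhaseCellIV], Appendix A part C, Theorem A.3 and its proof (A.27)–(A.31) p. 342
(render f4-p026 of unit `lit-balaban-r19`, read as an image).  Cell `lit-balaban`, Phase-2 proof seat **p04 gen 7**; SKELETON
rows **F4.ThmA.3** (decl of record `PhaseCellIVAppA.ThmA3ContCap`, p251889; fold owner r19) and F4.EqA.27-A.29 ((A.29): «a
function `d(x) ∈ C^∞`, `d : B → R¹`, such that `½d(x, ∂B) ≤ d(x) ≤ d(x, ∂B)`»).

WHAT IS PRINTED AND WHAT IS DONE HERE.  Print mollifies at the VARIABLE scale `εd(x)` ((A.30) `f^{s′}_ε(x) = ∫ w^{εd(x)}(x − y)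
f(y) dy`) with `d` a regularised distance to `∂B`.  We realise the same construction with the scale frozen dyadically: the
smooth scale function is `θ(x) = 1 − |x|²` (`½`-comparable with `d(x, ∂B) = 1 − |x|` on `B`: `1 − |x| ≤ θ(x) ≤ 2(1 − |x|)`),
the open ball is covered by the shells `{2^{−j−1} ≤ θ ≤ 2^{1−j}}`, and `ψ_j := Θ_{j+1} − Θ_j` with `Θ_j(x) :=
smoothTransition(2^jθ(x) − 1)` is a `C^∞` partition of unity of the open ball (`Σ_{j<J} ψ_j = Θ_J`, `= 1` where `θ ≥ 2^{1−J}`;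
`ψ_j = 0` where `θ ≤ 2^{−j−1}` or `θ ≥ 2^{1−j}`), whose derivatives obey the scale-invariant bounds `‖D^iψ_j(x)‖ ≤ P·2^{ji}`
(`i ≤ m`, `x ∈ B̄`; chain rule `norm_iteratedFDeriv_comp_le` with `sup|D^i smoothTransition| < ∞` and `sup_{B̄}‖D^iθ‖ < ∞`).
`BallSmoothing` then sets `f^{s′} := Σ_j ψ_j·(w^{ε2^{−j}} ⋆ f)`, which on the shell `j` is print's `w^{εd(x)} ⋆ f` up to the
factor-4 freezing of the scale — the constants `c_α` of (A.26) absorb it.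

WHAT THIS MODULE PROVIDES (namespace `BallCutoffs`, on `EuclideanSpace ℝ (Fin n)`): defs with bodies `theta` ((A.29)-type
scale), `Theta` (cumulative cutoffs), `psi` (the partition); theorems `contDiff_theta`, `theta_le_one`, `theta_pos`,
`theta_nonpos`, `one_sub_norm_le_theta`, `theta_le_two_mul`, `infDist_sphere_le_theta`, `exists_theta_bound`,
`exists_smoothTransition_bound`, `Theta_eq_zero`, `Theta_eq_one`, `Theta_zero`, `Theta_nonneg`, `Theta_le_one`, `contDiff_Theta`,
`exists_Theta_bound`, `psi_eq_zero_of_le`, `psi_eq_zero_of_ge`, `abs_psi_le_one`, `contDiff_psi`, `sum_psi_range`,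
`sum_psi_eq_one`, `psi_eventuallyEq_zero_of_lt`, `psi_eventuallyEq_zero_of_gt`, **`exists_psi_bound`**, `exists_level`.
No `Prop`-valued definition, no named fact; axioms standard.
-/

namespace Literature.MathematicalPhysics.QuantumFieldTheory.Federbush1986

noncomputable section

open Metric Set Filter Function Real
open scoped ContDiff Topology NNReal

namespace BallCutoffs

open LipschitzMollifier (Euc)

variable {n : ℕ}

/-! ## §1 The smooth scale function `θ(x) = 1 − |x|²` (the `d(x)` of (A.29) up to a factor 2) -/

/-- `θ(x) = 1 − |x|²`: a `C^∞` function with `½d(x,∂B)`-type comparability `1 − |x| ≤ θ(x) ≤ 2(1 − |x|)` on the ball — our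
instance of «a function `d(x) ∈ C^∞` … such that `½ d(x, ∂B) ≤ d(x) ≤ d(x, ∂B)` (A.29)» (here with the comparison constants
`1` and `2`). [cite: Federbush1988PhaseCellIV, (A.29) p. 342] -/
def theta (x : Euc n) : ℝ := 1 - ‖x‖ ^ 2

/-- `θ ∈ C^∞`. [cite: Federbush1988PhaseCellIV, (A.29) p. 342] -/
theorem contDiff_theta : ContDiff ℝ ∞ (theta : Euc n → ℝ) :=
  contDiff_const.sub (contDiff_norm_sq ℝ)

/-- `θ` is continuous. [cite: Federbush1988PhaseCellIV, (A.29) p. 342] -/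
theorem continuous_theta : Continuous (theta : Euc n → ℝ) := contDiff_theta.continuous

/-- `θ ≤ 1` everywhere. [cite: Federbush1988PhaseCellIV, (A.29) p. 342] -/
theorem theta_le_one (x : Euc n) : theta x ≤ 1 := by
  unfold theta; nlinarith [norm_nonneg x]

/-- `θ > 0` exactly on the open unit ball. [cite: Federbush1988PhaseCellIV, (A.29) p. 342] -/
theorem theta_pos {x : Euc n} (hx : x ∈ ball (0 : Euc n) 1) : 0 < theta x := by
  rw [mem_ball, dist_zero_right] at hx
  unfold theta; nlinarith [norm_nonneg x]

/-- `θ ≤ 0` off the open unit ball. [cite: Federbush1988PhaseCellIV, (A.29) p. 342] -/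
theorem theta_nonpos {x : Euc n} (hx : x ∉ ball (0 : Euc n) 1) : theta x ≤ 0 := by
  rw [mem_ball, dist_zero_right, not_lt] at hx
  unfold theta; nlinarith [norm_nonneg x]

/-- `θ(x) = 0` on the unit sphere. [cite: Federbush1988PhaseCellIV, (A.25)/(A.29) p. 342] -/
theorem theta_eq_zero_of_mem_sphere {x : Euc n} (hx : x ∈ sphere (0 : Euc n) 1) : theta x = 0 := by
  rw [mem_sphere, dist_zero_right] at hx
  simp [theta, hx]

/-- Lower comparison with the distance to the boundary: `d(x, ∂B) = 1 − |x| ≤ θ(x)` on the closed ball.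
[cite: Federbush1988PhaseCellIV, (A.29) p. 342] -/
theorem one_sub_norm_le_theta {x : Euc n} (hx : x ∈ closedBall (0 : Euc n) 1) : 1 - ‖x‖ ≤ theta x := by
  rw [mem_closedBall, dist_zero_right] at hx
  unfold theta; nlinarith [norm_nonneg x]

/-- Upper comparison: `θ(x) ≤ 2(1 − |x|) = 2 d(x, ∂B)`. [cite: Federbush1988PhaseCellIV, (A.29) p. 342] -/
theorem theta_le_two_mul (x : Euc n) : theta x ≤ 2 * (1 - ‖x‖) := by
  unfold theta; nlinarith [sq_nonneg (‖x‖ - 1)]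

/-- `d(x, ∂B) ≤ θ(x)` on the closed ball, with `d(x, ∂B) = infDist x (sphere 0 1)` (also when the sphere is empty, `n = 0`).
[cite: Federbush1988PhaseCellIV, (A.26)/(A.29) p. 342] -/
theorem infDist_sphere_le_theta {x : Euc n} (hx : x ∈ closedBall (0 : Euc n) 1) : infDist x (sphere (0 : Euc n) 1) ≤ theta x := by
  have hθ := one_sub_norm_le_theta hx
  rw [mem_closedBall, dist_zero_right] at hx
  by_cases hS : (sphere (0 : Euc n) 1).Nonempty
  · by_cases hx0 : x = 0
    · obtain ⟨y, hy⟩ := hS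
      have h1 : infDist x (sphere (0 : Euc n) 1) ≤ dist x y := infDist_le_dist_of_mem hy
      rw [mem_sphere, dist_zero_right] at hy
      rw [hx0, dist_zero_left, hy] at h1
      rw [hx0]; rw [hx0, norm_zero] at hθ
      linarith
    · have hnx : 0 < ‖x‖ := norm_pos_iff.2 hx0
      set y : Euc n := ‖x‖⁻¹ • x with hy_def
      have hy : y ∈ sphere (0 : Euc n) 1 := by
        rw [mem_sphere, dist_zero_right, hy_def, norm_smul, norm_inv, norm_norm, inv_mul_cancel₀ hnx.ne']
      have h1 : infDist x (sphere (0 : Euc n) 1) ≤ dist x y := infDist_le_dist_of_mem hy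
      have h2 : dist x y = 1 - ‖x‖ := by
        have hxy : x - y = (1 - ‖x‖⁻¹) • x := by rw [hy_def, sub_smul, one_smul]
        have hinv : ‖x‖⁻¹ * ‖x‖ = 1 := inv_mul_cancel₀ hnx.ne'
        have hle : 1 - ‖x‖⁻¹ ≤ 0 := by nlinarith [inv_pos.2 hnx]
        rw [dist_eq_norm, hxy, norm_smul, Real.norm_eq_abs, abs_of_nonpos hle]
        linear_combination hinv
      linarith
  · rw [not_nonempty_iff_eq_empty] at hS
    rw [hS, infDist_empty]
    linarith [norm_nonneg x]

/-- Uniform bounds for the derivatives of `θ` on the closed ball: `∃ T ≥ 1`, `‖D^iθ(x)‖ ≤ T` for `i ≤ m`, `|x| ≤ 1` (continuity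
of `D^iθ` on the compact ball). [cite: Federbush1988PhaseCellIV, (A.29) p. 342] -/
theorem exists_theta_bound (m : ℕ) :
    ∃ T : ℝ, 1 ≤ T ∧ ∀ i ≤ m, ∀ x ∈ closedBall (0 : Euc n) 1, ‖iteratedFDeriv ℝ i (theta : Euc n → ℝ) x‖ ≤ T := by
  have hT : ∀ i : ℕ, ∃ C : ℝ, ∀ x ∈ closedBall (0 : Euc n) 1, ‖iteratedFDeriv ℝ i (theta : Euc n → ℝ) x‖ ≤ C := fun i =>
    (isCompact_closedBall (0 : Euc n) 1).exists_bound_of_continuousOn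
      ((contDiff_theta.continuous_iteratedFDeriv (m := i) (mod_cast le_top)).continuousOn)
  choose C hC using hT
  refine ⟨max 1 ((Finset.range (m + 1)).sup' ⟨0, by simp⟩ C), le_max_left _ _, fun i hi x hx => ?_⟩
  refine (hC i x hx).trans ((Finset.le_sup' C (by simpa [Nat.lt_succ_iff] using hi)).trans (le_max_right _ _))

/-! ## §2 The smooth step and its derivative bounds -/

/-- For `i ≥ 1` the `i`-th derivative of Mathlib's `smoothTransition` vanishes outside `[0, 1]` (it is locally constant there).
[cite: Federbush1988PhaseCellIV, (A.27) p. 342] -/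
theorem iteratedFDeriv_smoothTransition_eq_zero {i : ℕ} (hi : i ≠ 0) {t : ℝ} (ht : t ∉ Icc (0 : ℝ) 1) :
    iteratedFDeriv ℝ i smoothTransition t = 0 := by
  rw [mem_Icc, not_and_or, not_le, not_le] at ht
  rcases ht with ht | ht
  · have hev : (smoothTransition : ℝ → ℝ) =ᶠ[𝓝 t] fun _ => (0 : ℝ) := by
      filter_upwards [Iio_mem_nhds ht] with s hs using smoothTransition.zero_of_nonpos (le_of_lt hs)
    rw [(hev.iteratedFDeriv ℝ i).eq_of_nhds, iteratedFDeriv_const_of_ne hi, Pi.zero_apply]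
  · have hev : (smoothTransition : ℝ → ℝ) =ᶠ[𝓝 t] fun _ => (1 : ℝ) := by
      filter_upwards [Ioi_mem_nhds ht] with s hs using smoothTransition.one_of_one_le (le_of_lt hs)
    rw [(hev.iteratedFDeriv ℝ i).eq_of_nhds, iteratedFDeriv_const_of_ne hi, Pi.zero_apply]

/-- `sup_t ‖D^i smoothTransition(t)‖ < ∞` for all `i ≤ m` (one constant `S ≥ 1`). [cite: Federbush1988PhaseCellIV, (A.27)
p. 342] -/
theorem exists_smoothTransition_bound (m : ℕ) :
    ∃ S : ℝ, 1 ≤ S ∧ ∀ i ≤ m, ∀ t : ℝ, ‖iteratedFDeriv ℝ i smoothTransition t‖ ≤ S := by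
  have hS : ∀ i : ℕ, ∃ C : ℝ, ∀ t ∈ Icc (0 : ℝ) 1, ‖iteratedFDeriv ℝ i smoothTransition t‖ ≤ C := fun i =>
    isCompact_Icc.exists_bound_of_continuousOn
      ((smoothTransition.contDiff.continuous_iteratedFDeriv (m := i) (mod_cast le_top)).continuousOn)
  choose C hC using hS
  refine ⟨max 1 ((Finset.range (m + 1)).sup' ⟨0, by simp⟩ C), le_max_left _ _, fun i hi t => ?_⟩
  by_cases ht : t ∈ Icc (0 : ℝ) 1
  · exact (hC i t ht).trans ((Finset.le_sup' C (by simpa [Nat.lt_succ_iff] using hi)).trans (le_max_right _ _))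
  · by_cases hi0 : i = 0
    · subst hi0
      rw [norm_iteratedFDeriv_zero, Real.norm_eq_abs, abs_of_nonneg (smoothTransition.nonneg t)]
      exact (smoothTransition.le_one t).trans (le_max_left _ _)
    · rw [iteratedFDeriv_smoothTransition_eq_zero hi0 ht, norm_zero]
      exact zero_le_one.trans (le_max_left _ _)

/-! ## §3 The cumulative cutoffs `Θ_j = smoothTransition(2^jθ − 1)` -/

/-- The affine rescaling `x ↦ 2^jθ(x) − 1` of the scale function. [cite: Federbush1988PhaseCellIV, (A.29)–(A.30) p. 342] -/
def aff (j : ℕ) (x : Euc n) : ℝ := (2 : ℝ) ^ j * theta x - 1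

/-- The cumulative cutoff `Θ_j(x) = smoothTransition(2^jθ(x) − 1)`: `= 0` where `θ ≤ 2^{−j}`, `= 1` where `θ ≥ 2^{1−j}`.
[cite: Federbush1988PhaseCellIV, (A.29)–(A.30) p. 342] -/
def Theta (j : ℕ) : Euc n → ℝ := smoothTransition ∘ aff j

/-- `aff j ∈ C^∞`. [cite: Federbush1988PhaseCellIV, (A.29) p. 342] -/
theorem contDiff_aff (j : ℕ) : ContDiff ℝ ∞ (aff j : Euc n → ℝ) :=
  (contDiff_const.mul contDiff_theta).sub contDiff_const

/-- `Θ_j ∈ C^∞`. [cite: Federbush1988PhaseCellIV, (A.29) p. 342] -/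
theorem contDiff_Theta (j : ℕ) : ContDiff ℝ ∞ (Theta j : Euc n → ℝ) :=
  smoothTransition.contDiff.comp (contDiff_aff j)

/-- `0 ≤ Θ_j ≤ 1`. [cite: Federbush1988PhaseCellIV, (A.27) p. 342] -/
theorem Theta_nonneg (j : ℕ) (x : Euc n) : 0 ≤ Theta j x := smoothTransition.nonneg _

/-- `Θ_j ≤ 1`. [cite: Federbush1988PhaseCellIV, (A.27) p. 342] -/
theorem Theta_le_one (j : ℕ) (x : Euc n) : Theta j x ≤ 1 := smoothTransition.le_one _

/-- `Θ_j(x) = 0` where `2^jθ(x) ≤ 1`. [cite: Federbush1988PhaseCellIV, (A.29)–(A.30) p. 342] -/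
theorem Theta_eq_zero {j : ℕ} {x : Euc n} (h : (2 : ℝ) ^ j * theta x ≤ 1) : Theta j x = 0 :=
  smoothTransition.zero_of_nonpos (by simp only [aff]; linarith)

/-- `Θ_j(x) = 1` where `2 ≤ 2^jθ(x)`. [cite: Federbush1988PhaseCellIV, (A.29)–(A.30) p. 342] -/
theorem Theta_eq_one {j : ℕ} {x : Euc n} (h : 2 ≤ (2 : ℝ) ^ j * theta x) : Theta j x = 1 :=
  smoothTransition.one_of_one_le (by simp only [aff]; linarith)

/-- `Θ_0 ≡ 0` (as `θ ≤ 1`). [cite: Federbush1988PhaseCellIV, (A.29) p. 342] -/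
theorem Theta_zero (x : Euc n) : Theta 0 x = 0 := Theta_eq_zero (by simpa using theta_le_one x)

/-- `Θ_j = 0` off the open ball. [cite: Federbush1988PhaseCellIV, (A.29) p. 342] -/
theorem Theta_eq_zero_of_not_mem_ball {j : ℕ} {x : Euc n} (hx : x ∉ ball (0 : Euc n) 1) : Theta j x = 0 :=
  Theta_eq_zero ((mul_nonpos_of_nonneg_of_nonpos (by positivity) (theta_nonpos hx)).trans zero_le_one)

/-- For `i ≥ 1`, `D^i(2^jθ − 1) = 2^j·D^iθ`. [cite: Federbush1988PhaseCellIV, (A.29) p. 342] -/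
theorem iteratedFDeriv_aff {i : ℕ} (hi : i ≠ 0) (j : ℕ) (x : Euc n) :
    iteratedFDeriv ℝ i (aff j : Euc n → ℝ) x = (2 : ℝ) ^ j • iteratedFDeriv ℝ i (theta : Euc n → ℝ) x := by
  have h1 : (aff j : Euc n → ℝ) = (fun x => (2 : ℝ) ^ j • theta x) + fun _ => (-1 : ℝ) := by
    ext y; simp [aff, smul_eq_mul]; ring
  have hs : ContDiff ℝ ∞ fun x : Euc n => (2 : ℝ) ^ j • theta x := contDiff_theta.const_smul _
  rw [h1, iteratedFDeriv_add_apply (hs.of_le (mod_cast le_top)).contDiffAt contDiffAt_const,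
    iteratedFDeriv_const_of_ne hi, Pi.zero_apply, add_zero,
    iteratedFDeriv_const_smul_apply' (contDiff_theta.of_le (mod_cast le_top)).contDiffAt]

/-- **Derivative bounds for the cutoffs.** With `S` from `exists_smoothTransition_bound m` and `T` from `exists_theta_bound n m`:
`‖D^iΘ_j(x)‖ ≤ i!·S·(2^jT)^i` for `1 ≤ i ≤ m`, `|x| ≤ 1` (chain rule `norm_iteratedFDeriv_comp_le`).
[cite: Federbush1988PhaseCellIV, (A.26)/(A.29) p. 342] -/
theorem norm_iteratedFDeriv_Theta_le {m : ℕ} {S T : ℝ} (hS : ∀ i ≤ m, ∀ t : ℝ, ‖iteratedFDeriv ℝ i smoothTransition t‖ ≤ S)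
    (hT1 : 1 ≤ T) (hT : ∀ i ≤ m, ∀ x ∈ closedBall (0 : Euc n) 1, ‖iteratedFDeriv ℝ i (theta : Euc n → ℝ) x‖ ≤ T)
    (j : ℕ) {i : ℕ} (hi : i ≤ m) {x : Euc n} (hx : x ∈ closedBall (0 : Euc n) 1) :
    ‖iteratedFDeriv ℝ i (Theta j : Euc n → ℝ) x‖ ≤ i.factorial * S * ((2 : ℝ) ^ j * T) ^ i := by
  unfold Theta
  refine norm_iteratedFDeriv_comp_le (smoothTransition.contDiff (n := i)) ((contDiff_aff j).of_le (mod_cast le_top)) le_rfl x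
    (fun k hk => hS k (hk.trans hi) _) fun k hk1 hk => ?_
  rw [iteratedFDeriv_aff (Nat.one_le_iff_ne_zero.mp hk1), norm_smul, Real.norm_eq_abs, abs_of_pos (by positivity)]
  have h2T : 1 ≤ (2 : ℝ) ^ j * T := one_le_mul_of_one_le_of_one_le (one_le_pow₀ (by norm_num)) hT1
  calc (2 : ℝ) ^ j * ‖iteratedFDeriv ℝ k (theta : Euc n → ℝ) x‖ ≤ (2 : ℝ) ^ j * T := by
        gcongr; exact hT k (hk.trans hi) x hx
    _ ≤ ((2 : ℝ) ^ j * T) ^ k := le_self_pow₀ h2T (Nat.one_le_iff_ne_zero.mp hk1)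

/-- One constant for all cutoffs: `∃ P ≥ 1` with `‖D^iΘ_j(x)‖ ≤ P·2^{ji}` for all `j`, all `i ≤ m`, `|x| ≤ 1`.
[cite: Federbush1988PhaseCellIV, (A.26)/(A.29) p. 342] -/
theorem exists_Theta_bound (m : ℕ) : ∃ P : ℝ, 1 ≤ P ∧ ∀ j i, i ≤ m → ∀ x ∈ closedBall (0 : Euc n) 1,
    ‖iteratedFDeriv ℝ i (Theta j : Euc n → ℝ) x‖ ≤ P * (2 : ℝ) ^ (j * i) := by
  obtain ⟨S, hS1, hS⟩ := exists_smoothTransition_bound m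
  obtain ⟨T, hT1, hT⟩ := exists_theta_bound (n := n) m
  refine ⟨m.factorial * S * T ^ m, ?_, fun j i hi x hx => ?_⟩
  · have h1 : (1 : ℝ) ≤ m.factorial := by exact_mod_cast Nat.one_le_iff_ne_zero.mpr (Nat.factorial_ne_zero m)
    exact one_le_mul_of_one_le_of_one_le (one_le_mul_of_one_le_of_one_le h1 hS1) (one_le_pow₀ hT1)
  by_cases hi0 : i = 0
  · subst hi0
    rw [norm_iteratedFDeriv_zero, Real.norm_eq_abs, abs_of_nonneg (Theta_nonneg j x), mul_zero, pow_zero, mul_one]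
    have h1 : (1 : ℝ) ≤ m.factorial := by exact_mod_cast Nat.one_le_iff_ne_zero.mpr (Nat.factorial_ne_zero m)
    exact (Theta_le_one j x).trans
      (one_le_mul_of_one_le_of_one_le (one_le_mul_of_one_le_of_one_le h1 hS1) (one_le_pow₀ hT1))
  · calc ‖iteratedFDeriv ℝ i (Theta j : Euc n → ℝ) x‖ ≤ i.factorial * S * ((2 : ℝ) ^ j * T) ^ i :=
          norm_iteratedFDeriv_Theta_le hS hT1 hT j hi hx
      _ = (i.factorial * S * T ^ i) * (2 : ℝ) ^ (j * i) := by rw [mul_pow, ← pow_mul]; ring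
      _ ≤ (m.factorial * S * T ^ m) * (2 : ℝ) ^ (j * i) := by
          have hf : (i.factorial : ℝ) ≤ m.factorial := by exact_mod_cast Nat.factorial_le hi
          have hp : T ^ i ≤ T ^ m := pow_le_pow_right₀ hT1 hi
          have hS0 : 0 ≤ S := by linarith
          apply mul_le_mul_of_nonneg_right _ (by positivity)
          exact mul_le_mul (mul_le_mul_of_nonneg_right hf hS0) hp (by positivity) (by positivity)

/-! ## §4 The partition of unity `ψ_j = Θ_{j+1} − Θ_j` of the open ball -/

/-- `ψ_j := Θ_{j+1} − Θ_j`, supported in the shell `2^{−j−1} ≤ θ ≤ 2^{1−j}`. [cite: Federbush1988PhaseCellIV, (A.29)–(A.30)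
p. 342] -/
def psi (j : ℕ) (x : Euc n) : ℝ := Theta (j + 1) x - Theta j x

/-- `ψ_j ∈ C^∞`. [cite: Federbush1988PhaseCellIV, (A.29) p. 342] -/
theorem contDiff_psi (j : ℕ) : ContDiff ℝ ∞ (psi j : Euc n → ℝ) := (contDiff_Theta (j + 1)).sub (contDiff_Theta j)

/-- `ψ_j(x) = 0` where `θ(x) ≤ 2^{−j−1}` (both cutoffs vanish); in particular off the open ball.
[cite: Federbush1988PhaseCellIV, (A.29)–(A.30) p. 342] -/
theorem psi_eq_zero_of_le {j : ℕ} {x : Euc n} (h : (2 : ℝ) ^ (j + 1) * theta x ≤ 1) : psi j x = 0 := by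
  have h' : (2 : ℝ) ^ j * theta x ≤ 1 := by
    by_cases hθ : 0 ≤ theta x
    · calc (2 : ℝ) ^ j * theta x ≤ (2 : ℝ) ^ (j + 1) * theta x :=
            mul_le_mul_of_nonneg_right (pow_le_pow_right₀ (by norm_num) (Nat.le_succ j)) hθ
        _ ≤ 1 := h
    · exact (mul_nonpos_of_nonneg_of_nonpos (by positivity) (le_of_not_ge hθ)).trans zero_le_one
  rw [psi, Theta_eq_zero h, Theta_eq_zero h', sub_zero]

/-- `ψ_j = 0` off the open ball. [cite: Federbush1988PhaseCellIV, (A.29) p. 342] -/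
theorem psi_eq_zero_of_not_mem_ball {j : ℕ} {x : Euc n} (hx : x ∉ ball (0 : Euc n) 1) : psi j x = 0 := by
  rw [psi, Theta_eq_zero_of_not_mem_ball hx, Theta_eq_zero_of_not_mem_ball hx, sub_zero]

/-- `ψ_j(x) = 0` where `θ(x) ≥ 2^{1−j}` (both cutoffs equal `1`). [cite: Federbush1988PhaseCellIV, (A.29)–(A.30) p. 342] -/
theorem psi_eq_zero_of_ge {j : ℕ} {x : Euc n} (h : 2 ≤ (2 : ℝ) ^ j * theta x) : psi j x = 0 := by
  have hθ : 0 ≤ theta x := by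
    by_contra hθ
    have : (2 : ℝ) ^ j * theta x ≤ 0 := mul_nonpos_of_nonneg_of_nonpos (by positivity) (le_of_not_ge hθ)
    linarith
  have h' : 2 ≤ (2 : ℝ) ^ (j + 1) * theta x :=
    h.trans (mul_le_mul_of_nonneg_right (pow_le_pow_right₀ (by norm_num) (Nat.le_succ j)) hθ)
  rw [psi, Theta_eq_one h, Theta_eq_one h', sub_self]

/-- `|ψ_j| ≤ 1`. [cite: Federbush1988PhaseCellIV, (A.27) p. 342] -/
theorem abs_psi_le_one (j : ℕ) (x : Euc n) : |psi j x| ≤ 1 := by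
  rw [psi, abs_le]
  constructor <;> linarith [Theta_nonneg (j + 1) x, Theta_le_one (j + 1) x, Theta_nonneg j x, Theta_le_one j x]

/-- Telescoping: `Σ_{j<J} ψ_j = Θ_J` (as `Θ_0 = 0`). [cite: Federbush1988PhaseCellIV, (A.29)–(A.30) p. 342] -/
theorem sum_psi_range (J : ℕ) (x : Euc n) : ∑ j ∈ Finset.range J, psi j x = Theta J x := by
  have := Finset.sum_range_sub (fun j => Theta j x) J
  simp only [psi]
  rw [this, Theta_zero, sub_zero]

/-- Partition of unity: `Σ_{j<J} ψ_j(x) = 1` where `2^Jθ(x) ≥ 2`, i.e. `θ(x) ≥ 2^{1−J}`.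
[cite: Federbush1988PhaseCellIV, (A.29)–(A.30) p. 342] -/
theorem sum_psi_eq_one {J : ℕ} {x : Euc n} (h : 2 ≤ (2 : ℝ) ^ J * theta x) : ∑ j ∈ Finset.range J, psi j x = 1 := by
  rw [sum_psi_range, Theta_eq_one h]

/-- `ψ_j ≡ 0` near any point with `2^{j+1}θ < 1`. [cite: Federbush1988PhaseCellIV, (A.29)–(A.30) p. 342] -/
theorem psi_eventuallyEq_zero_of_lt {j : ℕ} {x : Euc n} (h : (2 : ℝ) ^ (j + 1) * theta x < 1) :
    (psi j : Euc n → ℝ) =ᶠ[𝓝 x] fun _ => 0 := by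
  have hc : Continuous fun y : Euc n => (2 : ℝ) ^ (j + 1) * theta y := continuous_const.mul continuous_theta
  filter_upwards [hc.continuousAt.eventually_lt continuousAt_const h] with y hy using psi_eq_zero_of_le hy.le

/-- `ψ_j ≡ 0` near any point with `2^jθ > 2`. [cite: Federbush1988PhaseCellIV, (A.29)–(A.30) p. 342] -/
theorem psi_eventuallyEq_zero_of_gt {j : ℕ} {x : Euc n} (h : 2 < (2 : ℝ) ^ j * theta x) :
    (psi j : Euc n → ℝ) =ᶠ[𝓝 x] fun _ => 0 := by
  have hc : Continuous fun y : Euc n => (2 : ℝ) ^ j * theta y := continuous_const.mul continuous_theta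
  filter_upwards [continuousAt_const.eventually_lt hc.continuousAt h] with y hy using psi_eq_zero_of_ge hy.le

/-- **Derivative bounds for the partition.** `∃ P ≥ 0`: `‖D^iψ_j(x)‖ ≤ P·2^{ji}` for all `j`, `i ≤ m`, `|x| ≤ 1` — the scale
invariance `|D^α| ≲ d(x)^{−|α|}` of the cutoffs. [cite: Federbush1988PhaseCellIV, (A.26)/(A.29) p. 342] -/
theorem exists_psi_bound (m : ℕ) : ∃ P : ℝ, 0 ≤ P ∧ ∀ j i, i ≤ m → ∀ x ∈ closedBall (0 : Euc n) 1,
    ‖iteratedFDeriv ℝ i (psi j : Euc n → ℝ) x‖ ≤ P * (2 : ℝ) ^ (j * i) := by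
  obtain ⟨P, hP1, hP⟩ := exists_Theta_bound (n := n) m
  refine ⟨(2 ^ m + 1) * P, by positivity, fun j i hi x hx => ?_⟩
  have hfun : (psi j : Euc n → ℝ) = (Theta (j + 1) : Euc n → ℝ) - Theta j := by ext y; rfl
  rw [hfun, iteratedFDeriv_sub_apply ((contDiff_Theta (j + 1)).of_le (mod_cast le_top)).contDiffAt
    ((contDiff_Theta j).of_le (mod_cast le_top)).contDiffAt]
  calc ‖iteratedFDeriv ℝ i (Theta (j + 1) : Euc n → ℝ) x - iteratedFDeriv ℝ i (Theta j : Euc n → ℝ) x‖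
      ≤ ‖iteratedFDeriv ℝ i (Theta (j + 1) : Euc n → ℝ) x‖ + ‖iteratedFDeriv ℝ i (Theta j : Euc n → ℝ) x‖ := norm_sub_le _ _
    _ ≤ P * (2 : ℝ) ^ ((j + 1) * i) + P * (2 : ℝ) ^ (j * i) := add_le_add (hP (j + 1) i hi x hx) (hP j i hi x hx)
    _ = (2 ^ i + 1) * P * (2 : ℝ) ^ (j * i) := by rw [add_mul (j : ℕ) 1 i, one_mul, pow_add]; ring
    _ ≤ (2 ^ m + 1) * P * (2 : ℝ) ^ (j * i) := by
        have h2 : (2 : ℝ) ^ i ≤ 2 ^ m := pow_le_pow_right₀ (by norm_num) hi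
        have hP0 : 0 ≤ P := by linarith
        apply mul_le_mul_of_nonneg_right _ (by positivity)
        exact mul_le_mul_of_nonneg_right (by linarith) hP0

/-! ## §5 The dyadic level of an interior point -/

/-- The dyadic level of an interior point: for `0 < θ ≤ 1` there is `J` with `(1/2)^J < θ ≤ 2·(1/2)^J` (least `J` with
`(1/2)^J < θ`; `J ≥ 1`). [cite: Federbush1988PhaseCellIV, (A.29)–(A.30) p. 342] -/
theorem exists_level {θ : ℝ} (h0 : 0 < θ) (h1 : θ ≤ 1) :
    ∃ J : ℕ, 1 ≤ J ∧ (1 / 2 : ℝ) ^ J < θ ∧ θ ≤ 2 * (1 / 2 : ℝ) ^ J := by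
  classical
  have hex : ∃ J : ℕ, (1 / 2 : ℝ) ^ J < θ := exists_pow_lt_of_lt_one h0 (by norm_num)
  refine ⟨Nat.find hex, ?_, Nat.find_spec hex, ?_⟩
  · rw [Nat.one_le_iff_ne_zero]
    intro h
    have := Nat.find_spec hex
    rw [h, pow_zero] at this
    linarith
  · have hJ : Nat.find hex ≠ 0 := by
      intro h
      have := Nat.find_spec hex
      rw [h, pow_zero] at this
      linarith
    obtain ⟨K, hK⟩ := Nat.exists_eq_succ_of_ne_zero hJ
    have hmin : ¬ (1 / 2 : ℝ) ^ K < θ := Nat.find_min hex (by rw [hK]; exact Nat.lt_succ_self K)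
    rw [not_lt] at hmin
    rw [hK, pow_succ]
    linarith

end BallCutoffs

end

end Literature.MathematicalPhysics.QuantumFieldTheory.Federbush1986
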